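import Mathlib
import Summits.ValiantsHypothesis.ValiantsHypothesis.Theorems.ProofCarryingSymmetryRestorationQPESatCR
import Summits.ValiantsHypothesis.ValiantsHypothesis.Theorems.ProofCarryingSymmetryRestorationQPESatRename
import Summits.ValiantsHypothesis.ValiantsHypothesis.Theorems.ProofCarryingSymmetryRestorationQPESatPieces
import Summits.ValiantsHypothesis.ValiantsHypothesis.Theorems.ProofCarryingSymmetryRestorationQPESatEval
import Summits.ValiantsHypothesis.ValiantsHypothesis.Theorems.ProofCarryingSymmetryRestorationQPESatReach
import Summits.ValiantsHypothesis.ValiantsHypothesis.Theorems.ProofCarryingSymmetryRestorationQPESatKids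
import Summits.ValiantsHypothesis.ValiantsHypothesis.Theorems.ProofCarryingSymmetryRestorationQPACCircuitEval

/-!
# Route ProofCarryingSymmetry — crux `RestorationQP`, line `registered`: STABILITY AT DISTRIBUTIVITY
BUDGET ONE for an invariant generic instance (rung S3^(1)-inv)

Support file for the crux item `stmt-ValiantsHypothesis-10343` (lead c5, cycle 5): the first theorem
of the line at distributivity budget ONE.  Lead c4 reduced graded stability S3^(1) to its
combinatorial core CORE(1) (`stabilityAtDistOne_of_core`, p167773): for every `σ ∈ S_n` the
unfoldings `(C∘σ)•`, `C•` are congruent modulo the distributivity-free fragment AND one ground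
distributivity instance `e_σ`.  Here we settle the case of ONE instance `e = P·(Q+R) = P·Q + P·R`
serving all `σ`, which is GENERIC (`P`, `Q`, `R` keep a variable after constant folding) and
`S_n`-INVARIANT modulo the fragment (`σ•P ≡ P`, `σ•Q ≡ Q`, `σ•R ≡ R` in `UCEq`) — the "separable
template" situation `T_E = Σ_{a∈E} x_a·P(Q+R) + Σ_{a∉E} x_a·(PQ+PR)` of CYCLE4-REPORT.md, where the
stabiliser of the unfolding has exponential index but its e-saturation is symmetric:

* `esatClass_smul_eq` — INVARIANCE OF THE SATURATED CLASS: the semantic Church–Rosser theorem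
  (`acEq_esat_of_ucEqWith`, p170700), equivariance (`esat_rename`, p170250) and dependence on the
  instance only through the `UCEq`-classes of its pieces (`esat_acEq_of_pieces`, p170744) give
  `σ • esatClass d C = esatClass d C` for every `σ`;
* `stabilityAtDistOne_invariantGeneric` — hence the AC-canonical circuit of `esatClass d C`
  (lead c1's engine `acCircuit`, with the reach and multiplicity bounds `esat_card_reach`,
  `esat_card_kids`, p170938/p171022, and soundness `esat_eval`, p170776) is an `S_n`-SYMMETRIC labelled arithmetic circuit
  computing `Ĉ` of size `≤ (|C| + n + 2)^10`.

This is genuine restoration: the symmetric circuit is NOT the AC-canonical DAG of `C` (which is only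
`Stab(C•)`-symmetric) but of a transformed normal form.  Everything is proved; no named facts.
-/

-- single-problem summit: `Summit.ValiantsHypothesis.ValiantsHypothesis.…` is the namespace by design (D-0017)
set_option linter.dupNamespace false

noncomputable section

open scoped Classical

namespace Summit.ValiantsHypothesis.ValiantsHypothesis.Theorems

namespace ACStability

open Literature.Computability.AlgebraicComplexity ACClass

universe u v

variable {𝔽 : Type} [Field 𝔽] {X : Type}

/-- Genericity is invariant under renaming the instance. [folklore] -/
theorem DistData.Generic.rename {d : DistData 𝔽 X} (hg : d.Generic) {Y : Type} (f : X → Y) :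
    (d.rename f).Generic := by
  unfold DistData.Generic DistData.p DistData.q DistData.r at hg ⊢
  simp only [DistData.rename_P, DistData.rename_Q, DistData.rename_R, cnorm_rename, nvars_rename]
  exact hg

/-- **Invariance of the saturated class.**  If the pieces of a generic instance are `γ`-invariant
modulo the distributivity-free fragment and the renamed unfolding `(C∘γ)•` is congruent to `C•`
modulo the fragment and the instance, then `γ` fixes the class of the e-saturated unfolding.
[folklore] -/
theorem esatClass_smul_eq {Γ : Type} [Group Γ] [MulAction Γ X] {d : DistData 𝔽 X} (hg : d.Generic)
    {γ : Γ} (hP : UCEq (d.P.rename fun x => γ • x) d.P) (hQ : UCEq (d.Q.rename fun x => γ • x) d.Q)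
    (hR : UCEq (d.R.rename fun x => γ • x) d.R) {C : PICircuit 𝔽 X}
    (h : UCEqWith d.eqn (C.rename fun x => γ • x).unfold C.unfold) : γ • esatClass d C = esatClass d C := by
  unfold esatClass
  rw [smul_mk, ← Theorems.esat_rename γ d C.unfold, ← PICircuit.unfold_rename]
  exact (mk_eq_mk.2 (Theorems.esat_acEq_of_pieces (d.rename fun x => γ • x) d (hg.rename _) hP hQ hR _)).trans
    (mk_esat_eq_of_ucEqWith hg h)

/-- **The symmetric circuit** of an invariant generic instance: the AC-canonical circuit of the
e-saturated class is `Γ`-symmetric, computes `Ĉ` and has at most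
`2·(3(|C|+1)+12) + 2·(|C|+4)·(3(|C|+1)+12)²` gates. [folklore] -/
theorem exists_isSymmetric_of_ucEqWith {Γ : Type} [Group Γ] [MulAction Γ X] {d : DistData 𝔽 X}
    (hg : d.Generic)
    (hinv : ∀ γ : Γ, UCEq (d.P.rename fun x => γ • x) d.P ∧ UCEq (d.Q.rename fun x => γ • x) d.Q ∧
      UCEq (d.R.rename fun x => γ • x) d.R)
    (C : PICircuit 𝔽 X) (h : ∀ γ : Γ, UCEqWith d.eqn (C.rename fun x => γ • x).unfold C.unfold) :
    ∃ (G : Type) (_ : Fintype G) (D : LabelledArithCircuit 𝔽 X Unit G),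
      D.IsSymmetric Γ ∧ D.eval (D.output ()) = C.eval ∧
      Fintype.card G ≤ 2 * (3 * (C.size + 1) + 12) + 2 * (C.size + 4) * (3 * (C.size + 1) + 12) ^ 2 := by
  have hL : ∀ q ∈ reach (esatClass d C), Multiset.card q.kids < 2 ^ (C.size + 4) :=
    Theorems.esat_card_kids d hg C
  have ht : ∀ γ : Γ, γ • esatClass d C = esatClass d C := fun γ =>
    esatClass_smul_eq hg (hinv γ).1 (hinv γ).2.1 (hinv γ).2.2 (h γ)
  refine ⟨ACGate (esatClass d C) (C.size + 4), inferInstance, acCircuit (esatClass d C) (C.size + 4) hL,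
    isSymmetric_acCircuit hL ht, (eval_output_acCircuit hL).trans ?_,
    card_acGate_le (3 * (C.size + 1) + 12) (Theorems.esat_card_reach d hg C)⟩
  show (mk (esat d C.unfold)).eval = C.eval
  rw [eval_mk, Theorems.esat_eval d hg]
  rfl

/-- The gate count is `≤ (|C| + n + 2)^10`. [folklore] -/
theorem distOne_gate_bound (s n : ℕ) (hs : 1 ≤ s) :
    2 * (3 * (s + 1) + 12) + 2 * (s + 4) * (3 * (s + 1) + 12) ^ 2 ≤ (s + n + 2) ^ 10 := by
  have hA : 3 * (s + 1) + 12 ≤ 9 * (s + 2) := by omega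
  have hB : s + 4 ≤ 2 * (s + 2) := by omega
  have h3 : s + 2 ≤ (s + 2) ^ 3 := Nat.le_self_pow (by norm_num) _
  have h6 : 342 ≤ (s + 2) ^ 6 :=
    calc (342 : ℕ) ≤ 3 ^ 6 := by norm_num
      _ ≤ (s + 2) ^ 6 := Nat.pow_le_pow_left (by omega) 6
  calc 2 * (3 * (s + 1) + 12) + 2 * (s + 4) * (3 * (s + 1) + 12) ^ 2
      ≤ 2 * (9 * (s + 2)) + 2 * (2 * (s + 2)) * (9 * (s + 2)) ^ 2 := by gcongr
    _ = 18 * (s + 2) + 324 * (s + 2) ^ 3 := by ring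
    _ ≤ 342 * (s + 2) ^ 3 := by linarith
    _ ≤ (s + 2) ^ 6 * (s + 2) ^ 3 := Nat.mul_le_mul_right _ h6
    _ = (s + 2) ^ 9 := by ring
    _ ≤ (s + 2) ^ 10 := Nat.pow_le_pow_right (by omega) (by norm_num)
    _ ≤ (s + n + 2) ^ 10 := Nat.pow_le_pow_left (by omega) 10

end ACStability

open Literature.Computability.AlgebraicComplexity

/-- **Stability at distributivity budget ONE for an invariant generic instance** (rung S3^(1)-inv of
the line `registered` of crux `RestorationQP`, item stmt-ValiantsHypothesis-10343; the first case of
lead c4's CORE(1), `stabilityAtDistOne_of_core`).  Let `e : P·(Q+R) = P·Q + P·R` be a ground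
distributivity instance over `ℂ` in the matrix variables which is GENERIC (each of `P`, `Q`, `R`
keeps a variable after constant folding) and `S_n`-INVARIANT modulo the distributivity-free
fragment of `P_f` (A1–A5, A7–A10, R1–R4).  If for every `σ ∈ S_n` the renamed unfolding `(C∘σ)•` of
a Hrubeš–Tzameret circuit `C` is congruent to `C•` modulo that fragment AND the equation `e` (used
any number of times, both directions, under contexts — `ACStability.UCEqWith`), then an
`S_n`-symmetric labelled arithmetic circuit (Dawar–Wilsenach Def. 3.7) of size `≤ (|C|+n+2)^10`
computes `Ĉ`: the AC-canonical circuit of the e-SATURATED normal form of `C•`, which `σ` fixes by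
the semantic Church–Rosser theorem `esat_acEq_of_ucEqWith`. [folklore] -/
theorem stabilityAtDistOne_invariantGeneric : ∃ c : ℕ, ∀ (n : ℕ) (C : PICircuit ℂ (Fin n × Fin n)) (d : ACStability.DistData ℂ (Fin n × Fin n)), d.Generic → (∀ σ : Equiv.Perm (Fin n), ACStability.UCEq (d.P.rename fun x : Fin n × Fin n => σ • x) d.P ∧ ACStability.UCEq (d.Q.rename fun x : Fin n × Fin n => σ • x) d.Q ∧ ACStability.UCEq (d.R.rename fun x : Fin n × Fin n => σ • x) d.R) → (∀ σ : Equiv.Perm (Fin n), ACStability.UCEqWith d.eqn (C.rename fun x : Fin n × Fin n => σ • x).unfold C.unfold) → ∃ (G : Type) (_ : Fintype G) (D : LabelledArithCircuit ℂ (Fin n × Fin n) Unit G), D.IsSymmetric (Equiv.Perm (Fin n)) ∧ D.eval (D.output ()) = C.eval ∧ Fintype.card G ≤ (C.size + n + 2) ^ c := by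
  refine ⟨10, fun n C d hg hinv h => ?_⟩
  obtain ⟨G, hG, D, hsym, hev, hcard⟩ :=
    ACStability.exists_isSymmetric_of_ucEqWith (Γ := Equiv.Perm (Fin n)) hg hinv C h
  exact ⟨G, hG, D, hsym, hev, hcard.trans (ACStability.distOne_gate_bound C.size n C.one_le_size)⟩

end Summit.ValiantsHypothesis.ValiantsHypothesis.Theorems

end
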